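/-
Origin: expansion seat `prover-pub-hodgecm-mc-binder-2-g11-0`, handover #28b 2026-08-20T02:20Z md5 1842d7533207 (115 l.; CERTIFIED rc 0 / 0 warn / 36.2 s; g10's LEMMA B draft 3755ebdf2746 with only the provenance line changed; imports #28 + RUN-37 #18 `KappaEigen`; `follandFock_placePoly_eq_block` (the archimedean half of `ins_tprod_eq_block`), **`cmArchWeilRep_κ_follandFock_placePoly`** (a compact letter `κ k` of ONE place acts on an inserted pure tensor in its own slot by `vacScalar (placeVacExponents …) k` times the dictionary image; needs the small datum `hslot` of the block shape — superseded for compact letters AT ALL PLACES by #32, kept for the Σ₁₂ `K_V`-letters of (J-x₀)); axioms trio) (`HOME/mc/pub-hodgecm-mc-binder-2/g11/pkg/HodgeCM/Model/HypCensus/InsKappa.lean`, md5 1842d7533207, 115 lines);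
landed by the gen-14 packager (p-g14) in gate run 39 as `HodgeCM/Model/HypCensus/InsKappa.lean` (verbatim).
-/
/-
Origin: speedrun cell pub-hodgecm, MODEL-CONSTRUCTION sub-cell, lineage mc-binder-2 (BINDER-OWNERS rows 18/19: E binders
`hyp12` / `hyp34` of `Model.perL_picardCM_r15A`), seat prover-pub-hodgecm-mc-binder-2-g10-0 (gen 10), 2026-08-19.
Target in PKG: `HodgeCM/Model/HypCensus/InsKappa.lean` (NEW additive leaf; imports this lineage's `HypCensus/Ins` (#28) and
`HypCensus/KappaEigen` (#18, RUN 37 INSTALLED)).  KERNEL ONLY: 0 records, nothing cited, 0 `def … : Prop`; two theorems.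
Written by binder-2-g10 (draft 3755ebdf2746), certified by binder-2-g11 over the RUN-37 world (private mirror, header line only changed).
-/
import Summits.HodgeConjecture.HodgeCM.Model.HypCensus.Ins
import Summits.HodgeConjecture.HodgeCM.Model.HypCensus.KappaEigen

/-!
# Census kit (rows A12/A34): LEMMA B — a compact letter of one place acts on an inserted pure tensor in its own slot

`HypCensus/Ins` (#28) reads the archimedean part of an inserted printed pure tensor in the block frame of any place `v = cmPlacesEquiv L b`:
`follandFock cmBigFrame (∏_w placePoly m w) = F_v⁻¹(binvPi (rename (cmIdx v) (emb_b (m b))) ⊠ rest_v m)` (`follandFock_placePoly_eq_block`,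
the archimedean half of `ins_tprod_eq_block`).  `HypCensus/KappaEigen` (#18) computes the archimedean Weil action of a compact letter
`s_v(κ k)`, `k ∈ U(P) × U(Q) × U(R) × U(S)`, on such block vectors: `ω_∞(s_v(κ k)) F_v⁻¹(B⁻¹G ⊠ Φ₂) = vacScalar e_v k • F_v⁻¹(B⁻¹(linSubst (dualPairι k)⋆ G) ⊠ Φ₂)`
(`cmArchWeilRep_κ_binvPi`, `e_v = placeVacExponents …`).  Composing the two:

* **`cmArchWeilRep_κ_follandFock_placePoly`** (LEMMA B): if the letter `k` maps the embedded local vector `emb_b (m b)` to `emb_b y`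
  (`hk : linSubst (dualPairι k)⋆ (rename (cmIdx v) (emb_b (m b))) = rename (cmIdx v) (emb_b y)` — the per-kind DICTIONARIES #14 (Σ torus),
  #15 (Σ `K_V`), #16 (ι₁/D₁₂ torus), #20/#21 (invariants) supply exactly such identities), then
  `ω_∞(s_v(κ k)) (follandFock cmBigFrame (∏_w placePoly m w)) = vacScalar e_v k • follandFock cmBigFrame (∏_w placePoly (update m b y) w)`
  — the letter acts IN ITS OWN SLOT by the junction vacuum character times the dictionary image.  This is the common kernel of the
  census fields `omg_ins` ((J-T): torus letters at every place, then `cmPairRepTwist_archProdHom_tmul`) and `ins_mem` ((J-x₀): `K_V`-letters).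

Nothing here is a claim of PerL/QW8.  Style lint (L-notation): no `local notation`.
-/

set_option autoImplicit false

noncomputable section

open scoped TensorProduct Classical Matrix
open MvPolynomial NumberField NumberField.InfinitePlace Complex
open Literature.Analysis.SegalBargmann Literature.NumberTheory.Weil1964 Literature.NumberTheory.Automorphic
open Literature.NumberTheory.Automorphic.UnitaryGroup
open Literature.RepresentationTheory (atPlace)
open Literature.RepresentationTheory.KonnoKonno2007 Literature.RepresentationTheory.KonnoKonno2007.RealDualPair
open Literature.NumberTheory.GelbartRogawski1991 Literature.NumberTheory.GelbartRogawski1991.UnitaryDualPair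
open HodgeCM.PerL34.Fock HodgeCM.PerL34.Fock.PrintDict

namespace HodgeCM.Model.HypCensus

section Kappa

variable (L : Type) [Field L] [NumberField L] [IsCMField L]
variable (dV : Fin 3 → L) (hdV : ∀ i, IsCMField.complexConj L (dV i) = dV i) (hdV0 : ∀ i, dV i ≠ 0)
variable (dW : Fin 2 → L) (hdW : ∀ i, IsCMField.complexConj L (dW i) = dW i) (hdW0 : ∀ i, dW i ≠ 0)
variable (hGR : (cmSplittingDatum L finProdFinEquiv dV hdV hdV0 dW hdW hdW0).CompatibleSplitting) (ι₁ : L →+* ℂ)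
variable (datum : ∀ b : InfinitePlace L, PlaceDatum L dV hdV dW hdW ι₁ (cmPlacesEquiv L b))
variable (m₁ m₂ : InfinitePlace L → ℤ)

/-- **the archimedean part of an inserted pure tensor in the block frame of the place `b`**:
`follandFock cmBigFrame (∏_w placePoly m w) = F_v⁻¹(binvPi (rename (cmIdx v) (emb_b (m b))) ⊠ rest_v m)`, `v = cmPlacesEquiv L b`. -/
theorem follandFock_placePoly_eq_block (b : InfinitePlace L)
    (m : ∀ b : InfinitePlace L, ((printPlaces (InfinitePlace L) (kindOf L dV hdV dW hdW ι₁ datum)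
      (lamOf L dV hdV dW hdW ι₁ datum) (lamOf_ne_zero L dV hdV dW hdW ι₁ datum)
      (pinnedVacs (kindOf L dV hdV dW hdW ι₁ datum) m₁ m₂)).loc b).M) :
    follandFock (cmBigFrame L finProdFinEquiv dV hdV hdV0 dW hdW hdW0 ι₁)
        (∏ w, rename (atPlace w) (placePoly L dV hdV dW hdW ι₁ datum m₁ m₂ m w)) =
      (cmBlockFrameAt L finProdFinEquiv dV hdV hdV0 dW hdW hdW0 ι₁ (cmPlacesEquiv L b)
          (Equiv.refl _) (Equiv.refl _) (Equiv.refl _) (Equiv.refl _)).symm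
        (tensorPi (binvPi (rename (cmIdx L dV hdV dW hdW ι₁ (cmPlacesEquiv L b))
            (embOf L dV hdV dW hdW ι₁ datum m₁ m₂ b (m b))))
          (rest L dV hdV dW hdW ι₁ datum m₁ m₂ (cmPlacesEquiv L b) m)) := by
  rw [follandFock_prod_atPlace_eq_symm_tensorPi L finProdFinEquiv dV hdV hdV0 dW hdW hdW0 ι₁ (cmPlacesEquiv L b)
    (Equiv.refl _) (Equiv.refl _) (Equiv.refl _) (Equiv.refl _), placePoly_apply]
  rfl

/-- **LEMMA B — a compact letter of the place `b` acts on an inserted pure tensor in its own slot**: for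
`k ∈ U(P) × U(Q) × U(R) × U(S)` (blocks of `cmXV`/`cmXW` at `v = cmPlacesEquiv L b`) mapping the embedded local vector `emb_b (m b)` to
`emb_b y` (`hk`), the archimedean Weil action of the section `s_v(κ k)` multiplies by the junction vacuum character `vacScalar e_v k` and
replaces the `b`-slot by `y`.  [Folland1989, Prop. (4.39); KonnoKonno2007, Lemma 5.2 — via #18 `cmArchWeilRep_κ_binvPi`] -/
theorem cmArchWeilRep_κ_follandFock_placePoly (b : InfinitePlace L)
    (hsign : (∃ i₀ : Fin 3, (∀ i, i ≠ i₀ → 0 < (ι₁ (dV i)).re) ∨ ∀ i, i ≠ i₀ → (ι₁ (dV i)).re < 0) ∧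
      ((∀ j, 0 < (ι₁ (dW j)).re) ∨ ∀ j, (ι₁ (dW j)).re < 0) ∧
      (∀ τ : L →+* ℂ, InfinitePlace.mk τ ≠ InfinitePlace.mk ι₁ → (∀ i, 0 < (τ (dV i)).re) ∨ ∀ i, (τ (dV i)).re < 0) ∧
      (∀ τ : L →+* ℂ, InfinitePlace.mk τ ≠ InfinitePlace.mk ι₁ →
        (∃ j₀ : Fin 2, ∀ j, j ≠ j₀ → 0 < (τ (dW j)).re) ∨ ∀ j, (τ (dW j)).re < 0))
    (hslot : ∃ ω₁ : Representation ℂ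
        (Ginf (PosIdx (cmXV L dV hdV ι₁ (cmPlacesEquiv L b))) (NegIdx (cmXV L dV hdV ι₁ (cmPlacesEquiv L b)))
          (PosIdx (cmXW L dV dW hdW ι₁ (cmPlacesEquiv L b))) (NegIdx (cmXW L dV dW hdW ι₁ (cmPlacesEquiv L b))))
        (SchwartzMap (DPIdx (PosIdx (cmXV L dV hdV ι₁ (cmPlacesEquiv L b))) (NegIdx (cmXV L dV hdV ι₁ (cmPlacesEquiv L b)))
          (PosIdx (cmXW L dV dW hdW ι₁ (cmPlacesEquiv L b))) (NegIdx (cmXW L dV dW hdW ι₁ (cmPlacesEquiv L b))) → ℝ) ℂ),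
      IsArchWeilDatum (ι𝕎 _ _ _ _) ω₁ ∧ ∀ u, Continuous (ω₁ u))
    (k : DPK (PosIdx (cmXV L dV hdV ι₁ (cmPlacesEquiv L b))) (NegIdx (cmXV L dV hdV ι₁ (cmPlacesEquiv L b)))
      (PosIdx (cmXW L dV dW hdW ι₁ (cmPlacesEquiv L b))) (NegIdx (cmXW L dV dW hdW ι₁ (cmPlacesEquiv L b))))
    (m : ∀ b : InfinitePlace L, ((printPlaces (InfinitePlace L) (kindOf L dV hdV dW hdW ι₁ datum)
      (lamOf L dV hdV dW hdW ι₁ datum) (lamOf_ne_zero L dV hdV dW hdW ι₁ datum)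
      (pinnedVacs (kindOf L dV hdV dW hdW ι₁ datum) m₁ m₂)).loc b).M)
    (y : ((printPlaces (InfinitePlace L) (kindOf L dV hdV dW hdW ι₁ datum)
      (lamOf L dV hdV dW hdW ι₁ datum) (lamOf_ne_zero L dV hdV dW hdW ι₁ datum)
      (pinnedVacs (kindOf L dV hdV dW hdW ι₁ datum) m₁ m₂)).loc b).M)
    (hk : linSubst (star ((dualPairι k : Matrix.unitaryGroup _ ℂ) : Matrix _ _ ℂ))
        (rename (cmIdx L dV hdV dW hdW ι₁ (cmPlacesEquiv L b)) (embOf L dV hdV dW hdW ι₁ datum m₁ m₂ b (m b))) =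
      rename (cmIdx L dV hdV dW hdW ι₁ (cmPlacesEquiv L b)) (embOf L dV hdV dW hdW ι₁ datum m₁ m₂ b y)) :
    cmArchWeilRep L finProdFinEquiv dV hdV hdV0 dW hdW hdW0 hGR
        (cmBlockSectionAt L dV hdV hdV0 dW hdW hdW0 ι₁ (cmPlacesEquiv L b)
          (Equiv.refl _) (Equiv.refl _) (Equiv.refl _) (Equiv.refl _) (κ _ _ _ _ k))
        (follandFock (cmBigFrame L finProdFinEquiv dV hdV hdV0 dW hdW hdW0 ι₁)
          (∏ w, rename (atPlace w) (placePoly L dV hdV dW hdW ι₁ datum m₁ m₂ m w))) =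
      vacScalar (placeVacExponents L finProdFinEquiv dV hdV hdV0 dW hdW hdW0 hGR ι₁ (cmPlacesEquiv L b)
          (Equiv.refl _) (Equiv.refl _) (Equiv.refl _) (Equiv.refl _) hsign hslot) k •
        follandFock (cmBigFrame L finProdFinEquiv dV hdV hdV0 dW hdW hdW0 ι₁)
          (∏ w, rename (atPlace w) (placePoly L dV hdV dW hdW ι₁ datum m₁ m₂ (Function.update m b y) w)) := by
  rw [follandFock_placePoly_eq_block, follandFock_placePoly_eq_block, rest_update, Function.update_self,
    cmArchWeilRep_κ_binvPi L finProdFinEquiv dV hdV hdV0 dW hdW hdW0 hGR ι₁ (cmPlacesEquiv L b)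
      (Equiv.refl _) (Equiv.refl _) (Equiv.refl _) (Equiv.refl _) hsign hslot k, hk]

end Kappa

end HodgeCM.Model.HypCensus

end
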